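import Mathlib
import HarnessLib

/-!
# The normal strain on a reflection-symmetry plane of a 3D Euler flow obeys the forced Riccati law
# `D_t ∂₃u₃ = −(∂₃u₃)² − ∂₃²p` (Chae–Constantin–Wu 2012, §4.1) — the identity and the conditional blow-up

Analysis/FluidPDE proofs file (theorems only: no definition, no named fact). Source (HELD, read at the
pages cited): D. Chae, P. Constantin, J. Wu, *Deformation and symmetry in the inviscid SQG and the 3D
Euler equations*, J. Nonlinear Sci. **22** (2012) 665–688 [corpus: paper:doi-10-1007-s00332-012-9124-7,
pp. 680–681], §4 «The 3D Euler equations with spatial symmetries», §4.1 «Reflection with respect to the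
`x₁x₂`-plane»: for a solution `(u, p)` of the Euler equations with
`u₃(M₃x, t) = −u₃(x, t)`, `uⱼ(M₃x, t) = uⱼ(x, t)` (`j = 1, 2`), `p(M₃x, t) = p(x, t)`,
`M₃(x₁, x₂, x₃) = (x₁, x₂, −x₃)` (4.8), the reduced equations on the plane `x₃ = 0` are
`u₃ = ∂₃p = 0`, the planar transport of `u₁, u₂`, `div u = 0`, and «the `(3,3)` entry of the matrix
equation (4.4) is
  `∂ₜλ₃ + (u₁∂₁ + u₂∂₂)λ₃ = −λ₃² − ∂₃²p`,  where `λ₃ = ∂₃u₃`»  (4.9).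
**Theorem 4.1** (p. 681): with `S₀ = {a = (a₁, a₂, 0) | ∂₃u₃(a) < 0, ∂₃²p₀(a) > 0}` and the turnover
time `T₀(a) = inf {t > 0 | ∂₃²p(X(a, t), t) < 0}` along the in-plane particle trajectory `X(a, ·)`:
«if there exists `a ∈ S₀` such that `T₀(a) > −1/∂₃u₃(a)`, then `λ₃(X(a, t), t) = ∂₃u₃(X(a, t), t)`
decreases to `−∞` in a finite time»; its proof: «for any `t < T₀`, `∂ₜλ₃(X(a,t),t) ≤ −λ₃²(X(a,t),t)`.
Therefore … `λ(X(a,t),t) ≤ λ₀(a)/(1 + λ₀(a)t)`». **Corollary 4.2**: `∂₃u₃(a) < 0`, `∂₃²p₀(a) > 0` and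
`∂₃²p(X(a,t),t) > 0` for `t > 0` ⇒ `∂₃u₃(X(a,t),t) → −∞` as `t` approaches a finite time. (The axis
analogue — `λ = ∂₃v³` on the symmetry AXIS with `∂ᵣ²p ≥ 0` — is Chae, Nonlinearity **21** (2008)
2053–2060, Thm 1.1 [Chae2008]; CCW: «this section could be regarded as a generalized version of the
results in Chae (2008a)».)

## What is typed (namespace `Literature.Analysis.FluidPDE.ReflectionPlaneStrain`)

* §1 **(4.9) as an exact pointwise identity.** Fix `(x₁, x₂, t)` and regard the traces along the normal
  line as functions of `z = x₃` (separate function symbols, the idiom of the tree's `HouLuoOriginLaws` /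
  `HouLuoMirrorPlaneGerm`): `w = u₃`, `dw = ∂₃u₃`, `wt = ∂ₜu₃`, `w1 = ∂₁u₃`, `w2 = ∂₂u₃`, `v1 = u₁`,
  `v2 = u₂`, `pz = ∂₃p`, and a remainder `f` (`≡ 0` for Euler; `ν(Δu)₃ + f₃` for forced Navier–Stokes).
  If `wt + v1·w1 + v2·w2 + w·dw = −pz + f` along the line and ON THE PLANE `u₃ = ∂₁u₃ = ∂₂u₃ = 0`
  (value and tangential derivatives of the odd component), then differentiating once in `z` at `0`:
  `∂₃∂ₜu₃ + u₁·∂₃∂₁u₃ + u₂·∂₃∂₂u₃ = −(∂₃u₃)² − ∂₃²p + ∂₃f` (`normalStrain_transport_at_plane`, Euler form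
  `…_euler`); with Schwarz's exchange of mixed partials (the user's) this is (4.9),
  `D_tλ₃ = −λ₃² − ∂₃²p`, `D_t = ∂ₜ + u₁∂₁ + u₂∂₂` the material derivative ALONG THE PLANE. Parity helpers
  `eq_zero_of_odd`, `deriv_eq_zero_of_even` give `u₃ = ∂₃p = 0` on the plane from (4.8).
* §2 **Theorem 4.1 / Corollary 4.2 = the Riccati comparison along a trajectory.** For a differentiable
  `l` (`= λ₃(X(a, t), t)`) with `l' ≤ −l²` on `[0, T]` (= (4.9) while `∂₃²p ≥ 0`) and `l(0) < 0`: `l` is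
  non-increasing, `l(t) ≤ l(0)/(1 + l(0)t)` (the displayed bound) and `T < −1/l(0)` — a `C¹` strain
  history obeying the inequality cannot reach the time `−1/λ₃(a)` (`antitoneOn_of_deriv_le_neg_sq`,
  `le_div_of_deriv_le_neg_sq`, `time_lt_of_deriv_le_neg_sq`, wrapper `time_lt_of_pressureHessian_nonneg`).
* §3 **Reading**: under CCW's sign `∂₃²p ≥ 0` a non-zero normal strain is strictly decreasing along the
  flow, never stationary (`deriv_neg_of_pressureHessian_nonneg`). The threshold form with a pressure-Hessian
  bound of either sign (margin `−√B`), the stationary-strain reading `∂₃²p = −λ₃²` and the axisymmetric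
  mirror-plane specialisation are not printed in CCW and live on the cell side
  (`Summits/NavierStokesRegularity/OSWSelfSimilar/MirrorPlaneStrainRiccati`).

WHAT IS NOT HERE: existence / symmetry propagation for Euler solutions, the trajectory `X(a, t)`, Schwarz's
theorem, the identification of `l` with `λ₃ ∘ X` — the statements are about real functions satisfying the
displayed identities / inequalities (exactly the analytic content of CCW's proof). Nothing about
Navier–Stokes regularity. Everything proved (product rule at a point; monotonicity of `−1/l + t`).
Context: on the mirror plane `{z = 0}` of an axisymmetric
flow the plane-normal strain `∂_z u^z|₀ = −(∂ᵣ + r⁻¹)u^r|₀` is CCW's `λ₃` (cell ns-blowup, zone Z8).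
-/

noncomputable section

open Set Filter Real
open scoped Topology

namespace Literature.Analysis.FluidPDE
namespace ReflectionPlaneStrain

/-! ### §1 The reduced equation (4.9) at a point of the symmetry plane -/

/-- **CCW (4.9), general form with a remainder.** At fixed `(x₁, x₂, t)`, as functions of `z = x₃`:
if `wt z + v1 z * w1 z + v2 z * w2 z + w z * dw z = -(pz z) + f z` for all `z` (third momentum equation
along the normal line, `dw = ∂₃u₃`, remainder `f`), the odd component and its tangential derivatives
vanish on the plane (`w 0 = w1 0 = w2 0 = 0`), and the traces are differentiable at `0` with the named
derivative values, then
`∂₃uₜ + u₁·∂₃∂₁u₃ + u₂·∂₃∂₂u₃ = −(∂₃u₃)² − ∂₃²p + ∂₃f` at `z = 0`.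
[cite: ChaeConstantinWu2012, §4.1 eq. (4.9)] -/
theorem normalStrain_transport_at_plane (w dw wt w1 w2 v1 v2 pz f : ℝ → ℝ)
    (ddw0 wtz0 w1z0 w2z0 v1z0 v2z0 pzz0 fz0 : ℝ)
    (hE : ∀ z, wt z + v1 z * w1 z + v2 z * w2 z + w z * dw z = -(pz z) + f z)
    (hw0 : w 0 = 0) (hw10 : w1 0 = 0) (hw20 : w2 0 = 0)
    (hw : HasDerivAt w (dw 0) 0) (hdw : HasDerivAt dw ddw0 0) (hwt : HasDerivAt wt wtz0 0)
    (hw1 : HasDerivAt w1 w1z0 0) (hw2 : HasDerivAt w2 w2z0 0)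
    (hv1 : HasDerivAt v1 v1z0 0) (hv2 : HasDerivAt v2 v2z0 0)
    (hpz : HasDerivAt pz pzz0 0) (hf : HasDerivAt f fz0 0) :
    wtz0 + v1 0 * w1z0 + v2 0 * w2z0 = -(dw 0) ^ 2 - pzz0 + fz0 := by
  have hL : HasDerivAt (fun z => wt z + v1 z * w1 z + v2 z * w2 z + w z * dw z - (-(pz z) + f z))
      (wtz0 + (v1z0 * w1 0 + v1 0 * w1z0) + (v2z0 * w2 0 + v2 0 * w2z0)
        + (dw 0 * dw 0 + w 0 * ddw0) - (-pzz0 + fz0)) 0 :=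
    (((hwt.add (hv1.mul hw1)).add (hv2.mul hw2)).add (hw.mul hdw)).sub (hpz.neg.add hf)
  have hfun : (fun z => wt z + v1 z * w1 z + v2 z * w2 z + w z * dw z - (-(pz z) + f z))
      = fun _ => (0 : ℝ) := funext fun z => sub_eq_zero.mpr (hE z)
  have hZ : HasDerivAt (fun z => wt z + v1 z * w1 z + v2 z * w2 z + w z * dw z - (-(pz z) + f z))
      0 0 := by
    rw [hfun]
    exact hasDerivAt_const 0 0
  have huniq := hL.unique hZ
  rw [hw0, hw10, hw20] at huniq
  linear_combination huniq

/-- **CCW (4.9), Euler form.** As `normalStrain_transport_at_plane` with no remainder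
(`wt + v1·w1 + v2·w2 + w·dw = −pz` along the normal line): at `z = 0`,
`∂₃uₜ + u₁·∂₃∂₁u₃ + u₂·∂₃∂₂u₃ = −(∂₃u₃)² − ∂₃²p`, i.e. `∂ₜλ₃ + (u₁∂₁ + u₂∂₂)λ₃ = −λ₃² − ∂₃²p` once
mixed partials are exchanged. [cite: ChaeConstantinWu2012, §4.1 eq. (4.9)] -/
theorem normalStrain_transport_at_plane_euler (w dw wt w1 w2 v1 v2 pz : ℝ → ℝ)
    (ddw0 wtz0 w1z0 w2z0 v1z0 v2z0 pzz0 : ℝ)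
    (hE : ∀ z, wt z + v1 z * w1 z + v2 z * w2 z + w z * dw z = -(pz z))
    (hw0 : w 0 = 0) (hw10 : w1 0 = 0) (hw20 : w2 0 = 0)
    (hw : HasDerivAt w (dw 0) 0) (hdw : HasDerivAt dw ddw0 0) (hwt : HasDerivAt wt wtz0 0)
    (hw1 : HasDerivAt w1 w1z0 0) (hw2 : HasDerivAt w2 w2z0 0)
    (hv1 : HasDerivAt v1 v1z0 0) (hv2 : HasDerivAt v2 v2z0 0)
    (hpz : HasDerivAt pz pzz0 0) :
    wtz0 + v1 0 * w1z0 + v2 0 * w2z0 = -(dw 0) ^ 2 - pzz0 := by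
  have h := normalStrain_transport_at_plane w dw wt w1 w2 v1 v2 pz (fun _ => 0)
    ddw0 wtz0 w1z0 w2z0 v1z0 v2z0 pzz0 0 (fun z => by rw [hE z, add_zero]) hw0 hw10 hw20
    hw hdw hwt hw1 hw2 hv1 hv2 hpz (hasDerivAt_const 0 0)
  linarith

/-- **Parity bookkeeping behind «`u₃(x₁, x₂, 0, t) = ∂₃p(x₁, x₂, 0, t) = 0`» (CCW's reduced equations
after (4.8)): an odd trace vanishes on the plane.** If `g (-z) = -g z` for all `z` then `g 0 = 0` (applied
to `u₃`, `∂₁u₃`, `∂₂u₃`, `∂₃p` under the symmetry (4.8)). [cite: ChaeConstantinWu2012, §4.1 after (4.8)] -/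
theorem eq_zero_of_odd (g : ℝ → ℝ) (hodd : ∀ z, g (-z) = -g z) : g 0 = 0 := by
  have h := hodd 0
  rw [neg_zero] at h
  linarith

/-- **Parity bookkeeping behind «`∂₃p(x₁, x₂, 0, t) = 0`»: an even differentiable trace has zero normal
derivative on the plane.** If `g (-z) = g z` for all `z` and `g` has derivative `g'` at `0`, then `g' = 0`
(applied to `p`, `u₁`, `u₂` under (4.8)). [cite: ChaeConstantinWu2012, §4.1 after (4.8)] -/
theorem deriv_eq_zero_of_even (g : ℝ → ℝ) (g' : ℝ) (heven : ∀ z, g (-z) = g z)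
    (hg : HasDerivAt g g' 0) : g' = 0 := by
  have hfun : (fun z => g (-z)) = g := funext heven
  have h := deriv_comp_neg (f := g) (x := (0 : ℝ))
  rw [hfun, neg_zero, hg.deriv] at h
  linarith

/-! ### §2 The Riccati comparison along a trajectory (CCW Theorem 4.1 / Corollary 4.2) -/

/-- Antitone on `[a, b]` from pointwise `HasDerivAt` data with non-positive derivative. [folklore] -/
private theorem antitoneOn_Icc {g g' : ℝ → ℝ} {a b : ℝ} (hg : ∀ t ∈ Icc a b, HasDerivAt g (g' t) t)
    (hg' : ∀ t ∈ Icc a b, g' t ≤ 0) : AntitoneOn g (Icc a b) :=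
  antitoneOn_of_hasDerivWithinAt_nonpos (f' := g') (convex_Icc a b)
    (fun t ht => (hg t ht).continuousAt.continuousWithinAt)
    (fun t ht => (hg t (interior_subset ht)).hasDerivWithinAt)
    (fun t ht => hg' t (interior_subset ht))

/-- **The strain decreases while `∂₃²p ≥ 0`.** If `l' ≤ −l²` on `[0, T]` (this is (4.9) along the
trajectory on the set where `∂₃²p ≥ 0`: «`∂ₜλ₃(X(a,t),t) ≤ −λ₃²(X(a,t),t)`») then `l` is non-increasing
on `[0, T]`. [cite: ChaeConstantinWu2012, proof of Thm 4.1] -/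
theorem antitoneOn_of_deriv_le_neg_sq {l l' : ℝ → ℝ} {T : ℝ}
    (hl : ∀ t ∈ Icc 0 T, HasDerivAt l (l' t) t) (hle : ∀ t ∈ Icc 0 T, l' t ≤ -(l t) ^ 2) :
    AntitoneOn l (Icc 0 T) :=
  antitoneOn_Icc hl fun t ht => (hle t ht).trans (neg_nonpos.mpr (sq_nonneg _))

/-- **The reciprocal gains unit speed.** Under `l' ≤ −l²` on `[0, T]` and `l(0) < 0`: for every
`t ∈ [0, T]`, `l t < 0` and `−1/l(t) + t ≤ −1/l(0)` (since `(−1/l)' = l'/l² ≤ −1`).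
[cite: ChaeConstantinWu2012, proof of Thm 4.1] -/
theorem neg_inv_add_le_of_deriv_le_neg_sq {l l' : ℝ → ℝ} {T : ℝ}
    (hl : ∀ t ∈ Icc 0 T, HasDerivAt l (l' t) t) (hle : ∀ t ∈ Icc 0 T, l' t ≤ -(l t) ^ 2)
    (h0 : l 0 < 0) {t : ℝ} (ht : t ∈ Icc 0 T) : l t < 0 ∧ -(l t)⁻¹ + t ≤ -(l 0)⁻¹ := by
  have hanti := antitoneOn_of_deriv_le_neg_sq hl hle
  have hneg : ∀ s ∈ Icc 0 T, l s < 0 := fun s hs =>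
    (hanti (left_mem_Icc.2 (hs.1.trans hs.2)) hs hs.1).trans_lt h0
  refine ⟨hneg t ht, ?_⟩
  -- `q := −1/l + id` is non-increasing
  have hq : ∀ s ∈ Icc 0 T, HasDerivAt (fun s => -(l s)⁻¹ + s) (l' s / (l s) ^ 2 + 1) s := by
    intro s hs
    have h1 := ((hl s hs).inv (hneg s hs).ne).neg
    have h2 := h1.add (hasDerivAt_id' s)
    refine h2.congr_deriv ?_
    ring
  have hqanti : AntitoneOn (fun s => -(l s)⁻¹ + s) (Icc 0 T) := by
    refine antitoneOn_Icc hq fun s hs => ?_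
    have hl2 : 0 < (l s) ^ 2 := by rw [sq]; exact mul_pos_of_neg_of_neg (hneg s hs) (hneg s hs)
    have : l' s / (l s) ^ 2 ≤ -1 := by
      rw [div_le_iff₀ hl2]
      linarith [hle s hs]
    linarith
  simpa using hqanti (left_mem_Icc.2 (ht.1.trans ht.2)) ht ht.1

/-- **CCW Theorem 4.1 / Corollary 4.2 (finite-time breakdown along the trajectory).** If a
differentiable `l` satisfies `l' ≤ −l²` on `[0, T]` with `l(0) < 0`, then `T < −1/l(0)`: the strain
history cannot be continued, as a solution of the inequality, up to the time `−1/∂₃u₃(a)` («becomes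
`−∞` for `t ≤ −1/∂₃u₃(a)`»). [cite: ChaeConstantinWu2012, Thm 4.1 and Cor 4.2] -/
theorem time_lt_of_deriv_le_neg_sq {l l' : ℝ → ℝ} {T : ℝ} (hT : 0 ≤ T)
    (hl : ∀ t ∈ Icc 0 T, HasDerivAt l (l' t) t) (hle : ∀ t ∈ Icc 0 T, l' t ≤ -(l t) ^ 2)
    (h0 : l 0 < 0) : T < -(l 0)⁻¹ := by
  obtain ⟨hT0, hq⟩ := neg_inv_add_le_of_deriv_le_neg_sq hl hle h0 (right_mem_Icc.2 hT)
  have : 0 < -(l T)⁻¹ := neg_pos.mpr (inv_lt_zero.mpr hT0)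
  linarith

/-- **The displayed bound `λ(X(a,t),t) ≤ λ₀(a)/(1 + λ₀(a)t)`.** Under `l' ≤ −l²` on `[0, T]` and
`l(0) < 0`, for every `t ∈ [0, T]`: `1 + l(0)t > 0` and `l(t) ≤ l(0)/(1 + l(0)t)`.
[cite: ChaeConstantinWu2012, proof of Thm 4.1] -/
theorem le_div_of_deriv_le_neg_sq {l l' : ℝ → ℝ} {T : ℝ}
    (hl : ∀ t ∈ Icc 0 T, HasDerivAt l (l' t) t) (hle : ∀ t ∈ Icc 0 T, l' t ≤ -(l t) ^ 2)
    (h0 : l 0 < 0) {t : ℝ} (ht : t ∈ Icc 0 T) :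
    0 < 1 + l 0 * t ∧ l t ≤ l 0 / (1 + l 0 * t) := by
  obtain ⟨hlt, hq⟩ := neg_inv_add_le_of_deriv_le_neg_sq hl hle h0 ht
  have hpos : 0 < 1 + l 0 * t := by
    have h1 : t < -(l 0)⁻¹ := by
      have : 0 < -(l t)⁻¹ := neg_pos.mpr (inv_lt_zero.mpr hlt)
      linarith
    have h2 : l 0 * t > l 0 * (-(l 0)⁻¹) := mul_lt_mul_of_neg_left h1 h0
    have h3 : l 0 * (-(l 0)⁻¹) = -1 := by rw [mul_neg, mul_inv_cancel₀ h0.ne]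
    linarith
  refine ⟨hpos, ?_⟩
  have hinv : (l 0)⁻¹ + t ≤ (l t)⁻¹ := by linarith
  have hkey : (l 0 / (1 + l 0 * t))⁻¹ ≤ (l t)⁻¹ := by
    rw [inv_div, add_div, one_div, mul_div_cancel_left₀ t h0.ne]
    exact hinv
  have hnegq : l 0 / (1 + l 0 * t) < 0 := div_neg_of_neg_of_pos h0 hpos
  exact (inv_le_inv_of_neg hnegq hlt).1 hkey

/-- **Wrapper in CCW's variables.** If along the trajectory `l' = −l² − P` on `[0, T]` with the normal
pressure curvature `P = ∂₃²p(X(a,t),t) ≥ 0` there (i.e. `T ≤ T₀(a)`, the turnover time) and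
`l(0) = ∂₃u₃(a) < 0`, then `T < −1/∂₃u₃(a)`: the hypothesis `T₀(a) > −1/∂₃u₃(a)` of Theorem 4.1 is
incompatible with a classical strain history on `[0, T₀(a)]`. [cite: ChaeConstantinWu2012, Thm 4.1] -/
theorem time_lt_of_pressureHessian_nonneg {l l' P : ℝ → ℝ} {T : ℝ} (hT : 0 ≤ T)
    (hl : ∀ t ∈ Icc 0 T, HasDerivAt l (l' t) t)
    (heq : ∀ t ∈ Icc 0 T, l' t = -(l t) ^ 2 - P t) (hP : ∀ t ∈ Icc 0 T, 0 ≤ P t)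
    (h0 : l 0 < 0) : T < -(l 0)⁻¹ :=
  time_lt_of_deriv_le_neg_sq hT hl (fun t ht => by rw [heq t ht]; linarith [hP t ht]) h0

/-! ### §3 Reading: CCW's sign excludes a stationary strain -/

/-- **CCW's blow-up sign excludes a stationary non-zero strain.** If `l' = −l² − P` with `P ≥ 0` and
`l ≠ 0` at some instant, then `l' < 0` there: under `∂₃²p ≥ 0` a non-zero normal strain is strictly
decreasing along the flow, never stationary. [cite: ChaeConstantinWu2012, §4.1 (4.9)] -/
theorem deriv_neg_of_pressureHessian_nonneg {lt l P : ℝ} (heq : lt = -l ^ 2 - P) (hP : 0 ≤ P)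
    (hl : l ≠ 0) : lt < 0 := by
  have : 0 < l ^ 2 := by positivity
  linarith

end ReflectionPlaneStrain
end Literature.Analysis.FluidPDE
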